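import Mathlib
import HarnessLib
import Literature.Analysis.FluidPDE.VectorCalculus
import Literature.Analysis.FluidPDE.Vorticity
import Summits.NavierStokesRegularity.NavierStokesRegularity.Theses.ThreadingFlux
import Summits.NavierStokesRegularity.NavierStokesRegularity.Theses.UnthreadedRigidityDoor

/-!
# Crux idea «platonic-germ-sieve» — typed sketch (planner ns-idea-15 g11, lens «negation»)

Crux: stmt-NavierStokesRegularity-1222 `…Theses.ThreadingFlux.PoloidalLiouville` (wall W1 = registered stub
`stub_scalarLiouville`); secondary stmt-27585 `…Theses.UnthreadedRigidityDoor.UnthreadedRigidity` (W2).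
NS regularity is NOT proved.  `PoloidalLiouville`, `UnthreadedRigidity` and every `…Liouville` / `…Rigidity`
proposition below are OPEN; nothing in this file proves them.  Props + kernel-checked glue only, no `sorry`.

THE LEVER (new on this wall).  Impose a PLATONIC POINT GROUP `G` about the centre (`v ∘ g = g ∘ v` for the 24 rotations
of the cube — typed concretely below as `cubeRot` — or the 60 of the icosahedron).  Three exact consequences:

1. NO AXIS, NO CONSTANT.  `G` fixes no vector (`octahedral_fixesNoVector`, kernel) and preserves no line, so in the
   `G`-class the conclusion of W1 («`v(t, ·)` is constant») reads «`v ≡ 0`» (`symmetricLiouville_of_poloidalLiouville`,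
   kernel) and the conclusion of W2 («a rotational symmetry `A` exists») forces `v ≡ 0` as well (two non-parallel
   rotation axes generate `SO(3)`; a continuous `SO(3)`-equivariant divergence-free field vanishes).  Every nonzero
   `G`-equivariant unthreaded flow of the class is therefore a COUNTEREXAMPLE to W1 and to W2: the class is the typed home
   of the negation (`not_poloidalLiouville_of_symmetricCounterexample`, kernel), and conversely W1 restricted to the class
   can only be proved by an axis-free mechanism — every «find the axis / perturb off axisymmetry» tool of g0–g10 and of
   the UnthreadedRigidityDoor is void there.
2. DEGENERATE CENTRE.  Schur: `v(x₀) = 0`, `∇v(x₀) = 0` (no invariant vector, no invariant traceless quadric... the only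
   invariant 2-tensor is `δ`, killed by `div v = 0`), `Δv(x₀) = 0`; the toroidal potential has only `G`-invariant
   spherical harmonics (cube: degrees 0,4,6,8,9,10,12,12,…; icosahedron: 0,6,10,12,15,16,…).  All centre laws of the
   steady-centre sieve (g5: type N `ΔV(x₀) ≠ 0`, polhode/strain strata with `∇V(x₀) ≠ 0`) and the cubic Reynolds-quadrupole
   law (g0) are VACUOUS here: the Platonic class is exactly the untouched «fully degenerate centre» residue of C1*.
3. CHIRAL SELECTION RULE (the engine).  For odd `G`-equivariant jets the threading obstruction `X·curl((v·∇)v)` is an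
   odd `G`-invariant polynomial, hence a multiple of the CHIRAL invariant (`I₉ = xyz(x²−y²)(y²−z²)(z²−x²)` for the cube,
   `I₁₅` for the icosahedron): the steady unthreaded jet cascade has NO constraint below degree 9 (15) and then
   `1,1,2,3,4,5,7,…` constraints per odd stage (Molien), against free Stokes-harmonic data counted by `dim H_ℓ^G`.
   Exact sieve (sympy over ℚ, this card's RESULTS): vortical seed `β h₄ x` at degree 5; stages 9, 11, 13, 15 solve
   linearly (with a hidden pairing: the free data `(τ_ℓ, κ_ℓ)` enter first only through `τ_ℓ − (ℓ/4)(β/α)κ_ℓ`), the first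
   residual polynomial in the two moduli `(β, γ)` appears at stage 17, two more at 19, three at 21: the O-symmetric
   vortical steady germ is decided by a zero-dimensional elimination — `OctahedralCentreRigidity` below is the typed
   statement the sieve tests, `OctahedralVorticalGerm` its negation (the counterexample germ).

Nearest prior art: Brandolese, Math. Ann. 329 (2004) [arXiv:math/0304436] — polyhedral symmetry of NS data kills the low
MOMENTS at infinity (decay exponents 5/6/8 for T/O/I); here the same groups act at the CENTRE and on the threading
constraint (chirality), for unthreaded ancient/steady flows — absent there and in Kida–Pelz high-symmetric flows.
-/

namespace Summit.NavierStokesRegularity.NavierStokesRegularity.Cruxes.PoloidalLiouville.Platonic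

open scoped BigOperators Topology Classical MeasureTheory InnerProductSpace RealInnerProductSpace
open Filter Set Function MeasureTheory
open Summit.NavierStokesRegularity.NavierStokesRegularity.Theses

local notation "E" => EuclideanSpace ℝ (Fin 3)

/-! ## Symmetry classes -/

/-- `u` is equivariant under every map in `G` (about the origin): `u (g x) = g (u x)`. -/
def IsEquivariant (G : Set (E → E)) (u : E → E) : Prop :=
  ∀ g ∈ G, ∀ x, u (g x) = g (u x)

/-- `G` fixes no nonzero vector (true for the rotation groups of the Platonic solids and for the dihedral groups;
false for cyclic groups).  This is all the W1-glue uses. -/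
def FixesNoVector (G : Set (E → E)) : Prop :=
  ∀ b : E, (∀ g ∈ G, g b = b) → b = 0

/-- `G` preserves no line (irreducible on `ℝ³`: true for the tetrahedral, octahedral, icosahedral rotation groups,
false for cyclic AND dihedral groups).  This is what makes every axisymmetric mechanism void in the class. -/
def PreservesNoAxis (G : Set (E → E)) : Prop :=
  ∀ a : E, a ≠ 0 → ∃ g ∈ G, ∀ c : ℝ, g a ≠ c • a

/-- The signed coordinate permutation `x ↦ (sᵢ · x_{σ i})ᵢ`. -/
def cubeRot (σ : Equiv.Perm (Fin 3)) (s : Fin 3 → ℝ) (x : E) : E :=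
  WithLp.toLp 2 (fun i => s i * x (σ i))

/-- Data of a ROTATION of the cube `{±e₀, ±e₁, ±e₂}`: signs `±1` with `sign σ · ∏ sᵢ = 1` (24 elements: the group O). -/
def IsCubeRotationData (σ : Equiv.Perm (Fin 3)) (s : Fin 3 → ℝ) : Prop :=
  (∀ i, s i = 1 ∨ s i = -1) ∧ ((Equiv.Perm.sign σ : ℤ) : ℝ) * ∏ i, s i = 1

/-- The octahedral rotation group O as a set of self-maps of `ℝ³`. -/
def octahedral : Set (E → E) :=
  {g | ∃ σ s, IsCubeRotationData σ s ∧ g = cubeRot σ s}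

/-- KERNEL: O fixes no nonzero vector (the half-turns `diag(1,−1,−1)` and `diag(−1,−1,1)` already do it). -/
theorem octahedral_fixesNoVector : FixesNoVector octahedral := by
  intro b hb
  have d1 : IsCubeRotationData 1 ![1, -1, -1] :=
    ⟨by intro i; fin_cases i <;> simp, by simp [Fin.prod_univ_three]⟩
  have d2 : IsCubeRotationData 1 ![-1, -1, 1] :=
    ⟨by intro i; fin_cases i <;> simp, by simp [Fin.prod_univ_three]⟩
  have h1 := hb _ ⟨1, ![1, -1, -1], d1, rfl⟩
  have h2 := hb _ ⟨1, ![-1, -1, 1], d2, rfl⟩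
  have e0 := congrArg (fun v : E => v 0) h2
  have e1 := congrArg (fun v : E => v 1) h1
  have e2 := congrArg (fun v : E => v 2) h1
  simp [cubeRot] at e0 e1 e2
  ext i
  fin_cases i <;> simp <;> linarith

/-- KERNEL: O preserves no axis (the quarter-turns about `e₀` and `e₂` already do it).  This is the hypothesis under
which every axis-based W1/W2 mechanism is void in the class, and the instance the W2-glue needs. -/
theorem octahedral_preservesNoAxis : PreservesNoAxis octahedral := by
  intro a ha
  by_contra hcon
  push_neg at hcon
  -- quarter-turn about e₀ : x ↦ (x₀, -x₂, x₁)
  have d1 : IsCubeRotationData (Equiv.swap 1 2) ![1, -1, 1] :=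
    ⟨by intro i; fin_cases i <;> simp, by simp [Fin.prod_univ_three, Equiv.Perm.sign_swap']⟩
  -- quarter-turn about e₂ : x ↦ (-x₁, x₀, x₂)
  have d2 : IsCubeRotationData (Equiv.swap 0 1) ![-1, 1, 1] :=
    ⟨by intro i; fin_cases i <;> simp, by simp [Fin.prod_univ_three, Equiv.Perm.sign_swap']⟩
  obtain ⟨c, hc⟩ := hcon _ ⟨Equiv.swap 1 2, ![1, -1, 1], d1, rfl⟩
  obtain ⟨c', hc'⟩ := hcon _ ⟨Equiv.swap 0 1, ![-1, 1, 1], d2, rfl⟩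
  have e1 := congrArg (fun v : E => v 1) hc
  have e2 := congrArg (fun v : E => v 2) hc
  have f0 := congrArg (fun v : E => v 0) hc'
  have f1 := congrArg (fun v : E => v 1) hc'
  simp [cubeRot, Equiv.swap_apply_def] at e1 e2 f0 f1
  -- e1 : -a 2 = c * a 1, e2 : a 1 = c * a 2, f0 : -a 1 = c' * a 0, f1 : a 0 = c' * a 1
  have s12 : a 1 ^ 2 + a 2 ^ 2 = 0 := by linear_combination a 1 * e2 - a 2 * e1
  have s01 : a 0 ^ 2 + a 1 ^ 2 = 0 := by linear_combination a 0 * f1 - a 1 * f0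
  have h1 : a 1 = 0 := (pow_eq_zero_iff two_ne_zero).mp (by nlinarith [sq_nonneg (a 1), sq_nonneg (a 2)])
  have h2 : a 2 = 0 := (pow_eq_zero_iff two_ne_zero).mp (by nlinarith [sq_nonneg (a 1), sq_nonneg (a 2)])
  have h0 : a 0 = 0 := (pow_eq_zero_iff two_ne_zero).mp (by nlinarith [sq_nonneg (a 0), sq_nonneg (a 1)])
  apply ha
  ext i
  fin_cases i <;> simp [h0, h1, h2]

/-! ## W1 in a symmetry class, and the typed negation -/

/-- W1 (`PoloidalLiouville`, centre normalised to `0`) RESTRICTED to the `G`-equivariant class, with the conclusion it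
takes there: the flow VANISHES.  OPEN for `G` = O, I (it is implied by W1: `symmetricLiouville_of_poloidalLiouville`). -/
def SymmetricPoloidalLiouville (G : Set (E → E)) : Prop :=
  ∀ v : ℝ → E → E, Literature.Analysis.FluidPDE.IsBoundedAncientMildSolution 1 v →
    (∀ t < 0, AEStronglyMeasurable (v t) volume) →
    ContDiffOn ℝ (⊤ : ℕ∞) (Function.uncurry v) (Set.Iio 0 ×ˢ Set.univ) →
    (∀ t < 0, ∀ x, inner ℝ x (Literature.Analysis.FluidPDE.curl (v t) x) = 0) →
    (∀ t < 0, IsEquivariant G (v t)) →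
    ∀ t < 0, ∀ x, v t x = 0

/-- The NEGATION OBJECT: a bounded ancient mild solution, smooth, unthreaded about `0`, `G`-equivariant, not identically
zero at some negative time.  For `G` fixing no vector it refutes W1 (`not_poloidalLiouville_of_symmetricCounterexample`). -/
def SymmetricCounterexample (G : Set (E → E)) : Prop :=
  ∃ v : ℝ → E → E, Literature.Analysis.FluidPDE.IsBoundedAncientMildSolution 1 v ∧
    (∀ t < 0, AEStronglyMeasurable (v t) volume) ∧
    ContDiffOn ℝ (⊤ : ℕ∞) (Function.uncurry v) (Set.Iio 0 ×ˢ Set.univ) ∧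
    (∀ t < 0, ∀ x, inner ℝ x (Literature.Analysis.FluidPDE.curl (v t) x) = 0) ∧
    (∀ t < 0, IsEquivariant G (v t)) ∧
    ∃ t < 0, ∃ x, v t x ≠ 0

/-- KERNEL GLUE: W1 ⇒ W1|_G with conclusion `v ≡ 0`, for any `G` fixing no vector. -/
theorem symmetricLiouville_of_poloidalLiouville (G : Set (E → E)) (hG : FixesNoVector G)
    (h : ThreadingFlux.PoloidalLiouville) : SymmetricPoloidalLiouville G := by
  intro v hv hmeas hsm hunthr hequi t ht x
  have hx0 : ∃ x₀ : E, ∀ t < 0, ∀ x, inner ℝ (x - x₀) (Literature.Analysis.FluidPDE.curl (v t) x) = 0 :=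
    ⟨0, fun t ht x => by simpa using hunthr t ht x⟩
  obtain ⟨b, hb⟩ := h v hv hmeas hsm hx0 t ht
  have hfix : ∀ g ∈ G, g b = b := by
    intro g hg
    have := hequi t ht g hg x
    rw [hb (g x), hb x] at this
    exact this.symm
  rw [hb x, hG b hfix]

/-- The same glue for the UnthreadedDoor copy of the crux decl (identical statement). -/
theorem symmetricLiouville_of_poloidalLiouville' (G : Set (E → E)) (hG : FixesNoVector G)
    (h : UnthreadedDoor.PoloidalLiouville) : SymmetricPoloidalLiouville G :=
  symmetricLiouville_of_poloidalLiouville G hG h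

/-- KERNEL: a `G`-symmetric counterexample refutes W1. -/
theorem not_poloidalLiouville_of_symmetricCounterexample (G : Set (E → E)) (hG : FixesNoVector G)
    (hc : SymmetricCounterexample G) : ¬ ThreadingFlux.PoloidalLiouville := by
  intro h
  obtain ⟨v, hv, hmeas, hsm, hunthr, hequi, t, ht, x, hx⟩ := hc
  exact hx (symmetricLiouville_of_poloidalLiouville G hG h v hv hmeas hsm hunthr hequi t ht x)

/-- The octahedral instances (kernel). -/
theorem octahedralLiouville_of_poloidalLiouville (h : ThreadingFlux.PoloidalLiouville) :
    SymmetricPoloidalLiouville octahedral :=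
  symmetricLiouville_of_poloidalLiouville _ octahedral_fixesNoVector h

theorem not_poloidalLiouville_of_octahedralCounterexample (hc : SymmetricCounterexample octahedral) :
    ¬ ThreadingFlux.PoloidalLiouville :=
  not_poloidalLiouville_of_symmetricCounterexample _ octahedral_fixesNoVector hc

/-! ## The steady stratum and the sieve's conjecture -/

/-- Classical steady Navier–Stokes (`ν = 1`, no force) on an open set `U`. -/
def IsSteadyNSOn (U : Set E) (V : E → E) (p : E → ℝ) : Prop :=
  ContDiffOn ℝ 2 V U ∧ ContDiffOn ℝ 1 p U ∧
    (∀ x ∈ U, Literature.Analysis.FluidPDE.VectorCalculus.divergence V x = 0) ∧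
    ∀ x ∈ U, fderiv ℝ V x (V x) + gradient p x = Laplacian.laplacian V x

/-- STEADY STRATUM of W1 in the class `G` (OPEN): a bounded steady NS flow on `ℝ³`, unthreaded about `0` and
`G`-equivariant, vanishes.  For the octahedral class it follows from the local conjecture `OctahedralCentreRigidity`
and two classical facts (`octahedralSteadyLiouville_of_centreRigidity`, kernel). -/
def SymmetricSteadyLiouville (G : Set (E → E)) : Prop :=
  ∀ (V : E → E) (p : E → ℝ), IsSteadyNSOn Set.univ V p → (∃ B : ℝ, ∀ x, ‖V x‖ ≤ B) →
    (∀ x, inner ℝ x (Literature.Analysis.FluidPDE.curl V x) = 0) → IsEquivariant G V → ∀ x, V x = 0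

/-- THE SIEVE'S CONJECTURE (OPEN; local, real-analytic, purely about germs): a real-analytic steady NS germ on a ball
about `0`, unthreaded about `0` and O-equivariant, is IRROTATIONAL.  Evidence (RESULTS.md of this card, exact over ℚ):
the O-equivariant unthreaded jet cascade with vortical seed is consistent through degree 15 and meets 1 + 2 + 3
polynomial residual conditions on its two moduli at degrees 17, 19, 21.  Killable both ways by finishing that
elimination.  Irrotational O-germs exist (`∇h₄`, `∇h₆`, …) — the conclusion cannot be strengthened to `V = 0` locally. -/
def OctahedralCentreRigidity : Prop :=
  ∀ (V : E → E) (p : E → ℝ) (ρ : ℝ), 0 < ρ →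
    AnalyticOnNhd ℝ V (Metric.ball 0 ρ) → AnalyticOnNhd ℝ p (Metric.ball 0 ρ) →
    IsSteadyNSOn (Metric.ball 0 ρ) V p →
    (∀ x ∈ Metric.ball 0 ρ, inner ℝ x (Literature.Analysis.FluidPDE.curl V x) = 0) →
    (∀ x ∈ Metric.ball 0 ρ, ∀ σ s, IsCubeRotationData σ s → cubeRot σ s x ∈ Metric.ball 0 ρ →
        V (cubeRot σ s x) = cubeRot σ s (V x)) →
    ∀ x ∈ Metric.ball 0 ρ, Literature.Analysis.FluidPDE.curl V x = 0

/-- Its NEGATION, the counterexample GERM the negation lens hunts: an O-equivariant unthreaded steady analytic germ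
with vorticity.  (A germ is not yet a bounded entire flow; it is the first object any O-symmetric counterexample to
W1's steady stratum must contain.) -/
def OctahedralVorticalGerm : Prop :=
  ∃ (V : E → E) (p : E → ℝ) (ρ : ℝ), 0 < ρ ∧
    AnalyticOnNhd ℝ V (Metric.ball 0 ρ) ∧ AnalyticOnNhd ℝ p (Metric.ball 0 ρ) ∧
    IsSteadyNSOn (Metric.ball 0 ρ) V p ∧
    (∀ x ∈ Metric.ball 0 ρ, inner ℝ x (Literature.Analysis.FluidPDE.curl V x) = 0) ∧
    (∀ x ∈ Metric.ball 0 ρ, ∀ σ s, IsCubeRotationData σ s → cubeRot σ s x ∈ Metric.ball 0 ρ →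
        V (cubeRot σ s x) = cubeRot σ s (V x)) ∧
    ∃ x ∈ Metric.ball 0 ρ, Literature.Analysis.FluidPDE.curl V x ≠ 0

theorem octahedralVorticalGerm_iff_not : OctahedralVorticalGerm ↔ ¬ OctahedralCentreRigidity := by
  constructor
  · rintro ⟨V, p, ρ, hρ, hV, hp, hNS, hun, heq, x, hx, hne⟩ h
    exact hne (h V p ρ hρ hV hp hNS hun heq x hx)
  · intro h
    by_contra hc
    apply h
    intro V p ρ hρ hV hp hNS hun heq x hx
    by_contra hne
    exact hc ⟨V, p, ρ, hρ, hV, hp, hNS, hun, heq, x, hx, hne⟩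

/-- CLASSICAL FACT (support, S): steady NS solutions are real-analytic in the interior. -/
def SteadyNSAnalytic : Prop :=
  ∀ (U : Set E) (V : E → E) (p : E → ℝ), IsOpen U → IsSteadyNSOn U V p →
    AnalyticOnNhd ℝ V U ∧ AnalyticOnNhd ℝ p U

/-- CLASSICAL FACT (support, S): a bounded steady NS flow on `ℝ³` that is irrotational on some ball about `0` is constant
(analytic continuation of `curl V = 0`, then `ΔV = ∇ div V − curl curl V = 0` and Liouville for bounded harmonic maps). -/
def IrrotationalGermLiouville : Prop :=
  ∀ (V : E → E) (p : E → ℝ), IsSteadyNSOn Set.univ V p → (∃ B : ℝ, ∀ x, ‖V x‖ ≤ B) →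
    (∃ ρ : ℝ, 0 < ρ ∧ ∀ x ∈ Metric.ball 0 ρ, Literature.Analysis.FluidPDE.curl V x = 0) →
    ∃ b : E, ∀ x, V x = b

/-- KERNEL GLUE: the sieve's conjecture + the two classical facts give the steady stratum of W1 in the octahedral class. -/
theorem octahedralSteadyLiouville_of_centreRigidity (hA : SteadyNSAnalytic) (hL : IrrotationalGermLiouville)
    (hR : OctahedralCentreRigidity) : SymmetricSteadyLiouville octahedral := by
  intro V p hNS hB hun heq x
  have hNS1 : IsSteadyNSOn (Metric.ball 0 1) V p := by
    obtain ⟨h1, h2, h3, h4⟩ := hNS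
    exact ⟨h1.mono (Set.subset_univ _), h2.mono (Set.subset_univ _), fun y _ => h3 y (Set.mem_univ y),
      fun y _ => h4 y (Set.mem_univ y)⟩
  obtain ⟨hV, hp⟩ := hA Set.univ V p isOpen_univ hNS
  have hcurl : ∀ y ∈ Metric.ball (0 : E) 1, Literature.Analysis.FluidPDE.curl V y = 0 :=
    hR V p 1 one_pos (hV.mono (Set.subset_univ _)) (hp.mono (Set.subset_univ _)) hNS1
      (fun y _ => hun y) (fun y _ σ s hd _ => heq _ ⟨σ, s, hd, rfl⟩ y)
  obtain ⟨b, hb⟩ := hL V p hNS hB ⟨1, one_pos, hcurl⟩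
  have hfix : ∀ g ∈ octahedral, g b = b := by
    intro g hg
    have := heq g hg x
    rw [hb (g x), hb x] at this
    exact this.symm
  rw [hb x, octahedral_fixesNoVector b hfix]

/-! ## W2 in a symmetry class -/

/-- W2 (`UnthreadedRigidity`, centre `0`) RESTRICTED to the `G`-class with the conclusion it takes there when `G`
preserves no axis: the window solution VANISHES.  (Glue from `UnthreadedRigidity` is NOT kernel-proved here: it needs
«the symmetry algebra of a `G`-equivariant field is `G`-conjugation invariant» and «rotations about two non-parallel axes
generate SO(3)», then «a continuous SO(3)-equivariant divergence-free field on `ℝ³` is `0`».)  OPEN. -/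
def SymmetricWindowRigidity (G : Set (E → E)) : Prop :=
  ∀ (S : Set ℝ), IsOpen S → IsPreconnected S → ∀ (u : ℝ → E → E),
    ContinuousOn (Function.uncurry u) (S ×ˢ Set.univ) →
    (∀ t ∈ S, Literature.Analysis.FluidPDE.VectorCalculus.IsDivFree (u t)) →
    (∀ s ∈ S, ∀ t ∈ S, s < t → ∀ x, u t x =
        Literature.Analysis.UnboundedOperators.heatExtension (u s) (t - s) x -
          Literature.Analysis.FluidPDE.oseenDuhamel 1 s u u t x) →
    (∀ τ ∈ S, ∃ B : ℝ, ∀ t ∈ S, t ≤ τ → ∀ x, ‖u t x‖ ≤ B) →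
    (∀ t ∈ S, ∀ x, inner ℝ (Literature.Analysis.FluidPDE.curl (u t) x) x = 0) →
    (∀ t ∈ S, IsEquivariant G (u t)) →
    ∀ t ∈ S, ∀ x, u t x = 0

/-- Sanity: the crux decls this sketch is wired to (by name). -/
example : ThreadingFlux.PoloidalLiouville = UnthreadedDoor.PoloidalLiouville := rfl
#check @UnthreadedRigidityDoor.UnthreadedRigidity

end Summit.NavierStokesRegularity.NavierStokesRegularity.Cruxes.PoloidalLiouville.Platonic
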